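/-
Copyright: the b2b-balaban cell (near-miss cell 7), T⁴-continuum fan-out; row NE7b, carrier debt (c) of the COUNT route
(finding F-ne7bp1g22-1(c)), seat `t4-ne7b-formalise-leaf-02`.  Released under the licence of the surrounding project.
-/
import Literature.MathematicalPhysics.QuantumFieldTheory.Balaban1983to89.T4TaggedShapeBanking
import Summits.QuantumFields.BalabanUV.T4Continuum.Support.LateMergers

/-!
# The banked induction WITHOUT the renewal-at-reach clause: total booked cost

Summits-side support leaf of the T⁴-continuum cell (rung (B)+1 on a FINITE torus only; NOT infinite volume, NOT the
mass gap, NOT the Clay statement; NOT a proof of the spine estimate NE7b).  Row NE7b, route «COUNT»; the BANKING HALF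
of the carrier debt (c) recorded by the row owner (finding F-ne7bp1g22-1(c), GAPS; claim table
`t4/b2b-balaban-t4-ne7b-p1/LEAVES-NE7b.md` rulings v1.5).  [folklore] bookkeeping over the lineage's OWN typed carrier
(`T4PersistenceDictionary.Gen`, `T4PrintedShapeBanking.{floorK, sz, wfloor, cost, credit, Emarg, reserve}`,
`T4TaggedShapeBanking.{dictWT, costT, extnT, ConsistentT}`, `T4BankedInduction.{lifeCost, credits, banks, absorbed}`,
`LateMergers.FreshT`); nothing is quoted from print, nothing printed is asserted, no `def … : Prop` fact is minted (the
two definitions below are a parametrised PREDICATE and a real-valued BOOKKEEPING function), no `[cite:]` tag.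

WHY.  The landed admissibility predicate `T4PrintedShapeBanking.Consistent` ∕ `T4TaggedShapeBanking.ConsistentT`
records a renewal only AT THE BOOKED REACH (`h + 1 = G.reach`), and `renew_holds` ∕ `renewT_holds` USE the equality
(«at readiness the old component's booked cost is over», `Consistent.cost_eq_zero`).  Print renews at PHYSICAL
readiness, which may precede the booked bound; re-dating the renewal to the booked reach is conservative in the credit
but not in the window (the (2.5)-window may drop by a factor `L` in between, (2.9)), so `RenewAtReach` is a genuine
DISPLAYED restriction of the swarm rows S3–S7 (owner's F-ne7bp1g22-1(c)).  THIS LEAF removes the clause from the PRICE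
inequality: the banked induction is run on the TOTAL BOOKED COST of a genealogy — every event's whole window floor and
whole size epoch, wherever they sit — instead of the life cost.  The total cost dominates the life cost (costs are
nonnegative), it is EXACTLY additive along the three constructors (no geometry: a renewal adds its window, a merger
adds the two partners and the extension), and the three per-event pay inequalities are the landed ones
(`bornT_holds` verbatim; the renewal and merger ones re-proved WITHOUT `cost_eq_zero`).  Hence the conclusion of
`T4BankedInduction.banked_induction` — `lifeCost + banks + reserve root ≤ credits` — and its exponentiated
records-currency form hold for every FRESH genealogy that is `ConsistentTLE`: `ConsistentT` VERBATIM except the renewal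
clause `h + 1 ≤ G.reach` (readiness no later than the booked bound — what the geometric layer H1b supplies: physical
life ≤ booked reach).  Generic in the label type `ε` with shape map `sh : ε → PEv` (flat chain: `sh = id`; tagged ∕
[CONV-D]-at-`D = 0` chain: names with shapes).

WHAT (this file = part 1 of 2).  §1 `ConsistentTLE` + `of_consistentT`, `root_spec`, `absorbed_spec`, `step_le`.  §2
`evCost`, `totalCostT`, `sum_le_evCost`, `lifeCost_le_totalCostT`, `totalCostT_born ∕ _renew ∕ _merge` (exact
additivity).  §3 the pay inequalities `bornLE_pay` (from `bornT_holds`), `renewLE_pay` (no reach clause), `mergeLE_pay`.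
§4 Sanity: an EARLY renewal (readiness three steps before the booked reach) is `ConsistentTLE`, not `ConsistentT`, and
fresh.  Part 2 (`Support/HistoryBankingLEInduction.lean`): **`bankedLE_total`**, **`bankedLE_induction`**,
**`rawFactorLE_le_recordPrice`** (the exact shape of `T4BankedInduction.rawFactor_le_recordPrice`).

NOT DONE HERE.  The exits (`CountThresholdUniform.relWeightBoundZ_of_irThreshold`,
`CountThresholdExit.relWeightBound_lateMergers_of_irThreshold`) still ask `Consistent` ∕ `ConsistentTH` BY NAME — letting
them accept `ConsistentTLE` is the owner's remaining half of debt (c); the cover side needs nothing (`Gen.WF`'s renewal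
clause `rootStep ≤ h < reach` already admits early renewals, `Gen.covers` unchanged); late mergers `D > 0` untouched.
NE7b NOT proved; spine 0/9.  HONEST DEPENDENCY (cell): continuum YM on T⁴ ⇐ BetaPertH ∧ nine spine estimates (0/9
proved); BetaPertH ⇐ (D1) ∧ (D4) ∧ CAP+tail.  This file changes none of it.
-/

open Finset
open Literature.MathematicalPhysics.QuantumFieldTheory.Balaban1983to89
open T4PersistenceDictionary T4PrintedShapeBanking T4BankedInduction T4BranchingRecordsGas T4TaggedShapeBanking
open Summit.QuantumFields.BalabanUV.T4Continuum.LateMergers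

namespace Summit.QuantumFields.BalabanUV.T4Continuum.HistoryBankingLE

noncomputable section

/-! ## §1 Consistency with EARLY renewals -/

section ConsistentLE

variable {ε : Type*}

/-- **`ConsistentTLE sh C K R`** — `T4TaggedShapeBanking.ConsistentT` VERBATIM except the renewal clause: a renewal
label has kind `1`, step `h + 1 ≤ K`, and readiness `h + 1 ≤ reach` (NO LATER than the booked reach; `ConsistentT` asks
`=`).  Births and mergers unchanged (kind `0` at its own step `≤ K`; kind `2` at a step `≤ K` inside both partners'
booked lives). [folklore] -/
def ConsistentTLE (sh : ε → PEv) (C : T4PrintedShapeBanking.Consts) (K : ℕ) (R : ℕ → ℕ) : Gen ε → Prop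
  | Gen.born b j => (sh b).kind = 0 ∧ (sh b).step = j ∧ j ≤ K
  | Gen.renew G e h => ConsistentTLE sh C K R G ∧ (sh e).kind = 1 ∧ (sh e).step = h + 1 ∧
      h + 1 ≤ G.reach (dictWT sh R C.n₁) ∧ h + 1 ≤ K
  | Gen.merge X Y e => ConsistentTLE sh C K R X ∧ ConsistentTLE sh C K R Y ∧ (sh e).kind = 2 ∧
      X.rootStep ≤ (sh e).step ∧ (sh e).step < X.reach (dictWT sh R C.n₁) ∧
      Y.rootStep ≤ (sh e).step ∧ (sh e).step < Y.reach (dictWT sh R C.n₁) ∧ (sh e).step ≤ K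

variable {sh : ε → PEv} {C : T4PrintedShapeBanking.Consts} {K : ℕ} {R : ℕ → ℕ}

/-- `ConsistentT` (renewal AT the reach) is the special case. [folklore] -/
theorem ConsistentTLE.of_consistentT : ∀ {G : Gen ε}, ConsistentT sh C K R G → ConsistentTLE sh C K R G
  | Gen.born _ _, hc => hc
  | Gen.renew G e h, hc => by
      simp only [ConsistentT] at hc
      obtain ⟨hG, hk, hs, hr, hK⟩ := hc
      exact ⟨ConsistentTLE.of_consistentT hG, hk, hs, hr.le, hK⟩
  | Gen.merge X Y e, hc => by
      simp only [ConsistentT] at hc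
      obtain ⟨hX, hY, hk, hx, hx', hy, hy', hK⟩ := hc
      exact ⟨ConsistentTLE.of_consistentT hX, ConsistentTLE.of_consistentT hY, hk, hx, hx', hy, hy', hK⟩

/-- the root has birth shape, at `rootStep`. [folklore] -/
theorem ConsistentTLE.root_spec :
    ∀ {G : Gen ε}, ConsistentTLE sh C K R G → (sh G.root).kind = 0 ∧ (sh G.root).step = G.rootStep
  | Gen.born b j, hc => by
      simp only [ConsistentTLE] at hc
      exact ⟨by simpa using hc.1, by simpa using hc.2.1⟩
  | Gen.renew G e h, hc => by
      simp only [ConsistentTLE] at hc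
      simpa using ConsistentTLE.root_spec hc.1
  | Gen.merge X Y e, hc => by
      simp only [ConsistentTLE] at hc
      obtain ⟨hX, hY, -⟩ := hc
      have h1 := ConsistentTLE.root_spec hX
      have h2 := ConsistentTLE.root_spec hY
      rw [root_merge, Gen.rootStep_merge]
      split_ifs with h
      · exact ⟨h1.1, by rw [h1.2, min_eq_left h]⟩
      · exact ⟨h2.1, by rw [h2.2, min_eq_right (not_le.mp h).le]⟩

/-- the absorbed root of a merger has birth shape, no later than the merger step. [folklore] -/
theorem ConsistentTLE.absorbed_spec {X Y : Gen ε} {e : ε} (hc : ConsistentTLE sh C K R (Gen.merge X Y e)) :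
    (sh (absorbed X Y)).kind = 0 ∧ (sh (absorbed X Y)).step ≤ (sh e).step := by
  simp only [ConsistentTLE] at hc
  obtain ⟨hX, hY, -, hx, -, hy, -, -⟩ := hc
  unfold absorbed
  split_ifs
  · exact ⟨(ConsistentTLE.root_spec hY).1, by rw [(ConsistentTLE.root_spec hY).2]; exact hy⟩
  · exact ⟨(ConsistentTLE.root_spec hX).1, by rw [(ConsistentTLE.root_spec hX).2]; exact hx⟩

variable [DecidableEq ε]

/-- every event is a performed step: `(sh e).step ≤ K`. [folklore] -/
theorem ConsistentTLE.step_le : ∀ {G : Gen ε}, ConsistentTLE sh C K R G → ∀ e ∈ G.events, (sh e).step ≤ K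
  | Gen.born b j, hc, e, he => by
      simp only [ConsistentTLE] at hc
      simp only [Gen.events_born, mem_singleton] at he
      subst he
      omega
  | Gen.renew G e h, hc, e', he' => by
      simp only [ConsistentTLE] at hc
      obtain ⟨hG, -, hs, -, hK⟩ := hc
      simp only [Gen.events_renew, mem_insert] at he'
      rcases he' with rfl | he'
      · omega
      · exact ConsistentTLE.step_le hG e' he'
  | Gen.merge X Y e, hc, e', he' => by
      simp only [ConsistentTLE] at hc
      obtain ⟨hX, hY, -, -, -, -, -, hK⟩ := hc
      simp only [Gen.events_merge, mem_insert, mem_union] at he'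
      rcases he' with rfl | he' | he'
      · exact hK
      · exact ConsistentTLE.step_le hX e' he'
      · exact ConsistentTLE.step_le hY e' he'

end ConsistentLE

/-! ## §2 The total booked cost: domination of the life cost and exact additivity -/

section Total

variable {ε : Type*} [DecidableEq ε] (sh : ε → PEv) (C : T4PrintedShapeBanking.Consts) (K : ℕ) (R : ℕ → ℕ)

/-- **THE BOOKED COST OF ONE EVENT** placed at `p`: the floor over its whole window `[p, p + W e)` plus its whole size
cost over its epoch. [folklore] -/
def evCost (p : ℕ) (e : ε) : ℝ :=
  ∑ n ∈ Finset.Ico p (p + dictWT sh R C.n₁ e), floorK C K R n + ∑ n ∈ supp C (sh e), sz C K R (sh e) n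

/-- **THE TOTAL BOOKED COST** of a genealogy: every event's booked cost at its placement. [folklore] -/
def totalCostT (G : Gen ε) : ℝ := ∑ e ∈ G.events, evCost sh C K R (G.place (dictWT sh R C.n₁) e) e

variable {sh C K R}

omit [DecidableEq ε] in
/-- over ANY set of steps, an event's window floor plus size cost sums to at most its booked cost. [folklore] -/
theorem sum_le_evCost (hE₂ : 0 ≤ C.E₂) (hE₃ : 0 ≤ C.E₃) (A : Finset ℕ) (p : ℕ) (e : ε) :
    ∑ n ∈ A, (wfloor C K R p (sh e) n + sz C K R (sh e) n) ≤ evCost sh C K R p e := by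
  unfold evCost
  rw [sum_add_distrib]
  refine add_le_add ?_ ?_
  · calc ∑ n ∈ A, wfloor C K R p (sh e) n
        ≤ ∑ n ∈ Finset.Ico p (p + dictWT sh R C.n₁ e), wfloor C K R p (sh e) n :=
          sum_le_sum_of_vanish (fun n => wfloor_nonneg hE₂ p (sh e) n) fun n hn => wfloor_of_not_mem hn
      _ = ∑ n ∈ Finset.Ico p (p + dictWT sh R C.n₁ e), floorK C K R n := sum_wfloor_eq subset_rfl
  · exact sum_le_sum_of_vanish (fun n => sz_nonneg hE₃ (sh e) n) fun n hn => sz_eq_zero_of_not_mem hn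

omit [DecidableEq ε] in
/-- the booked cost of an event is nonnegative. [folklore] -/
theorem evCost_nonneg (hE₂ : 0 ≤ C.E₂) (hE₃ : 0 ≤ C.E₃) (p : ℕ) (e : ε) : 0 ≤ evCost sh C K R p e :=
  le_trans (by simp) (sum_le_evCost hE₂ hE₃ ∅ p e)

/-- **THE LIFE COST IS AT MOST THE TOTAL BOOKED COST** (the life cost sums the same nonnegative per-event terms over
the life only). [folklore] -/
theorem lifeCost_le_totalCostT (hE₂ : 0 ≤ C.E₂) (hE₃ : 0 ≤ C.E₃) (G : Gen ε) :
    lifeCost (dictWT sh R C.n₁) (costT sh C K R) G ≤ totalCostT sh C K R G := by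
  unfold lifeCost totalCostT costT
  rw [sum_comm]
  exact sum_le_sum fun e _ => sum_le_evCost hE₂ hE₃ _ _ e

/-- a bare region books its own event's cost at its birth step. [folklore] -/
theorem totalCostT_born (b : ε) (j : ℕ) : totalCostT sh C K R (Gen.born b j) = evCost sh C K R j b := by
  simp [totalCostT]

/-- a renewal (new label) adds its own booked cost, placed at `h + 1`; the old placements are unchanged. [folklore] -/
theorem totalCostT_renew {G : Gen ε} {e : ε} (he : e ∉ G.events) (h : ℕ) :
    totalCostT sh C K R (Gen.renew G e h) = totalCostT sh C K R G + evCost sh C K R (h + 1) e := by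
  unfold totalCostT
  rw [Gen.events_renew, sum_insert he, Gen.place_renew_self, add_comm]
  congr 1
  exact sum_congr rfl fun e' he' => by
    have hne : e' ≠ e := fun hq => he (hq ▸ he')
    rw [Gen.place_renew, if_neg hne]

omit [DecidableEq ε] in
/-- the merger's own booked cost, placed at the later partner reach, IS the extension `extnT`. [folklore] -/
theorem evCost_merge_eq_extnT (X Y : Gen ε) (e : ε) :
    evCost sh C K R (max (X.reach (dictWT sh R C.n₁)) (Y.reach (dictWT sh R C.n₁))) e = extnT sh C K R X Y e := rfl

/-- a merger (fresh label, disjoint partner labels) books both partners' totals plus the extension — EXACTLY, with no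
timing hypothesis. [folklore] -/
theorem totalCostT_merge {X Y : Gen ε} {e : ε} (heX : e ∉ X.events) (heY : e ∉ Y.events)
    (hXY : Disjoint X.events Y.events) :
    totalCostT sh C K R (Gen.merge X Y e) = totalCostT sh C K R X + totalCostT sh C K R Y + extnT sh C K R X Y e := by
  have he : e ∉ X.events ∪ Y.events := by simp [heX, heY]
  have hX : ∑ e' ∈ X.events, evCost sh C K R ((Gen.merge X Y e).place (dictWT sh R C.n₁) e') e' =
      ∑ e' ∈ X.events, evCost sh C K R (X.place (dictWT sh R C.n₁) e') e' :=
    sum_congr rfl fun e' he' => by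
      have hne : e' ≠ e := fun hq => heX (hq ▸ he')
      rw [Gen.place_merge, if_neg hne, if_pos he']
  have hY : ∑ e' ∈ Y.events, evCost sh C K R ((Gen.merge X Y e).place (dictWT sh R C.n₁) e') e' =
      ∑ e' ∈ Y.events, evCost sh C K R (Y.place (dictWT sh R C.n₁) e') e' :=
    sum_congr rfl fun e' he' => by
      have hne : e' ≠ e := fun hq => heY (hq ▸ he')
      rw [Gen.place_merge, if_neg hne, if_neg (disjoint_right.1 hXY he')]
  unfold totalCostT
  rw [Gen.events_merge, sum_insert he, sum_union hXY, Gen.place_merge_self, hX, hY, evCost_merge_eq_extnT]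
  ring

end Total

/-! ## §3 The three per-event pay inequalities, no reach clause -/

section Pay

variable {ε : Type*} [DecidableEq ε] {sh : ε → PEv} {C : T4PrintedShapeBanking.Consts} {K L : ℕ} {R : ℕ → ℕ}
  {g : ℕ → ℝ} {β' β₀ : ℝ}

/-- a birth's booked cost is the cost it books over its own window (its epoch `(j, j + fatWait d′]` lies inside the
window `[j, j + fatWait d′ + R_j + 1)`). [folklore] -/
theorem evCost_born_eq {b : ε} {j : ℕ} (hk : (sh b).kind = 0) (hs : (sh b).step = j) :
    evCost sh C K R j b = ∑ n ∈ Finset.Ico j (j + dictWT sh R C.n₁ b), costT sh C K R (Gen.born b j) n := by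
  have hsub : supp C (sh b) ⊆ Finset.Ico j (j + dictWT sh R C.n₁ b) := fun n hn => by
    simp only [supp, mem_Ioc, fw_kind0 hk, hs] at hn
    rw [mem_Ico, dictWT_kind0 hk, hs]
    omega
  unfold evCost
  rw [sum_congr rfl fun n _ => costT_born (sh := sh) (C := C) (K := K) (R := R) b j n, sum_add_distrib,
    sum_wfloor_eq subset_rfl, ← sum_subset hsub fun n _ hn => sz_eq_zero_of_not_mem hn]

/-- **BIRTH** (= `T4TaggedShapeBanking.bornT_holds`, read on the booked cost): the birth exponent pays the event's whole
booked cost, its bank and its reserve. [folklore] -/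
theorem bornLE_pay (hC : C.Valid) (h29 : B14FlowStep.FlowIneq29 R g L β' β₀ K) (hL : 1 ≤ L)
    (hR1 : ∀ s, s ≤ K → 1 ≤ R s)
    (Hb : ∀ s, s ≤ K → ∀ d' : ℕ,
      (C.Eb + C.μ + (3 * C.E₂ * (L : ℝ) ^ C.q' + C.E₃ * (L : ℝ) ^ C.q' + 3 * C.κ₁) * (R s : ℝ) ^ (C.q' + 1)) *
          ((d' : ℝ) + 1) + 2 * p0Profile C.A₀ C.p₀ (g s) ≤
        C.a * (p0Profile C.A₀ C.p₀ (g s)) ^ 2 * ((d' : ℝ) + 1) + 2 * p0Profile C.A₀ C.p₀ (g s))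
    (b : ε) (j : ℕ) (hc : ConsistentTLE sh C K R (Gen.born b j)) :
    evCost sh C K R j b + (C.κ₁ * ((dictWT sh R C.n₁ b : ℕ) : ℝ) + Emarg C (sh b)) + reserve C g (sh b) ≤
      credit C g (sh b) := by
  have hc' : ConsistentT sh C K R (Gen.born b j) := hc
  rw [evCost_born_eq hc.1 hc.2.1]
  exact bornT_holds hC h29 hL hR1 Hb b j hc'

omit [DecidableEq ε] in
/-- **RENEWAL, NO REACH CLAUSE**: the fresh factor `p₀(g_h)` pays the floor over the renewal's own window
`[h+1, h+2+R_{h+1})` and its bank — whatever the old component still has booked there (that is paid by the old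
component's own credits, inside `totalCostT G`). [folklore] -/
theorem renewLE_pay (hC : C.Valid) (h29 : B14FlowStep.FlowIneq29 R g L β' β₀ K) (hL : 1 ≤ L)
    (hR1 : ∀ s, s ≤ K → 1 ≤ R s)
    (Hr : ∀ h, h + 1 ≤ K →
      2 * C.E₂ * (L : ℝ) ^ C.q' * (R (h + 1) : ℝ) ^ (C.q' + 1) + (C.κ₁ * ((R (h + 1) : ℝ) + 1) + C.E₀) ≤
        p0Profile C.A₀ C.p₀ (g h))
    {e : ε} {h : ℕ} (hk : (sh e).kind = 1) (hs : (sh e).step = h + 1) (hK : h + 1 ≤ K) :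
    evCost sh C K R (h + 1) e + (C.κ₁ * ((dictWT sh R C.n₁ e : ℕ) : ℝ) + Emarg C (sh e)) ≤ credit C g (sh e) := by
  have hWn : dictWT sh R C.n₁ e = R (h + 1) + 1 := by rw [dictWT_kind1 hk, hs]
  have hcr : credit C g (sh e) = p0Profile C.A₀ C.p₀ (g h) := by rw [credit_kind1 hk, hs, Nat.add_sub_cancel]
  have hsz : ∑ n ∈ supp C (sh e), sz C K R (sh e) n = 0 := by
    refine sum_eq_zero fun n hn => ?_
    simp [supp, fw_kind1 hk] at hn
  rw [hcr, Emarg_kind1 hk, evCost, hsz, add_zero]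
  have hfl := sum_floorK_le h29 hL hC.E₂_nonneg (s := h + 1) (T := Finset.Ico (h + 1) (h + 1 + dictWT sh R C.n₁ e))
    (fun n hn => (mem_Ico.1 hn).1)
  rw [Nat.card_Ico, Nat.add_sub_cancel_left, hWn, mul_pow] at hfl
  push_cast at hfl
  have hP : (1 : ℝ) ≤ R (h + 1) := by exact_mod_cast hR1 (h + 1) hK
  have key := renew_arith (Lq := (L : ℝ) ^ C.q') (E₂ := C.E₂) hP (by positivity) hC.E₂_nonneg C.q'
  have hpay := Hr h hK
  rw [hWn]
  push_cast
  linarith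

omit [DecidableEq ε] in
/-- **MERGER** (= `T4TaggedShapeBanking.mergeT_pay_holds` under `ConsistentTLE`): the absorbed root's reserve pays the
extension and the merger's bank. [folklore] -/
theorem mergeLE_pay (hC : C.Valid) (h29 : B14FlowStep.FlowIneq29 R g L β' β₀ K) (hL : 1 ≤ L)
    (hR1 : ∀ s, s ≤ K → 1 ≤ R s)
    (Hm : ∀ m s, m ≤ s → s ≤ K →
      ((1 + C.n₁) * C.E₂ * (L : ℝ) ^ C.q' + C.dC * C.E₃ * (L : ℝ) ^ C.q') * (R s : ℝ) ^ (C.q' + 1) +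
          (C.κ₁ * ((C.n₁ : ℝ) + R s) + C.E₀) ≤ 2 * p0Profile C.A₀ C.p₀ (g m))
    (X Y : Gen ε) (e : ε) (hc : ConsistentTLE sh C K R (Gen.merge X Y e)) :
    extnT sh C K R X Y e + (C.κ₁ * ((dictWT sh R C.n₁ e : ℕ) : ℝ) + Emarg C (sh e)) ≤
      reserve C g (sh (absorbed X Y)) + credit C g (sh e) := by
  have hab := ConsistentTLE.absorbed_spec hc
  have hc' := hc
  simp only [ConsistentTLE] at hc'
  obtain ⟨-, -, hk, -, hx', -, -, hsK⟩ := hc'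
  have hWn : dictWT sh R C.n₁ e = C.n₁ + R (sh e).step := dictW_kind2 hk
  unfold extnT
  rw [credit_kind2 hk, Emarg_kind2 hk, reserve_kind0 hab.1, hWn]
  have hfl : ∑ n ∈ Finset.Ico (max (X.reach (dictWT sh R C.n₁)) (Y.reach (dictWT sh R C.n₁)))
        (max (X.reach (dictWT sh R C.n₁)) (Y.reach (dictWT sh R C.n₁)) + (C.n₁ + R (sh e).step)), floorK C K R n ≤
      ((C.n₁ + R (sh e).step : ℕ) : ℝ) * (C.E₂ * ((L : ℝ) * R (sh e).step) ^ C.q') := by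
    have h := sum_floorK_le h29 hL hC.E₂_nonneg (s := (sh e).step)
      (T := Finset.Ico (max (X.reach (dictWT sh R C.n₁)) (Y.reach (dictWT sh R C.n₁)))
        (max (X.reach (dictWT sh R C.n₁)) (Y.reach (dictWT sh R C.n₁)) + (C.n₁ + R (sh e).step)))
      (fun n hn => by
        have h1 := (mem_Ico.1 hn).1
        have h2 : (sh e).step < max (X.reach (dictWT sh R C.n₁)) (Y.reach (dictWT sh R C.n₁)) :=
          lt_of_lt_of_le hx' (le_max_left _ _)
        omega)
    rwa [Nat.card_Ico, Nat.add_sub_cancel_left] at h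
  have hszs : ∑ n ∈ supp C (sh e), sz C K R (sh e) n ≤ C.E₃ * ((L : ℝ) * R (sh e).step) ^ C.q' * C.dC := by
    have h := sum_supp_sz_le h29 hC.E₃_nonneg (sh e)
    rwa [wt_kind2 hk] at h
  rw [mul_pow] at hfl hszs
  push_cast at hfl
  have hP : (1 : ℝ) ≤ R (sh e).step := by exact_mod_cast hR1 (sh e).step hsK
  have key := merge_arith (Lq := (L : ℝ) ^ C.q') (E₂ := C.E₂) (E₃ := C.E₃) (n₁ := (C.n₁ : ℝ)) (dC := (C.dC : ℝ))
    hP (by positivity) hC.E₂_nonneg hC.E₃_nonneg (Nat.cast_nonneg _) (Nat.cast_nonneg _) C.q'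
  have hpay := Hm (sh (absorbed X Y)).step (sh e).step hab.2 hsK
  push_cast
  linarith

end Pay

/-! ## §4 Sanity: an early renewal -/

namespace Sanity

open T4PrintedShapeBanking.XreadC4

/-- tagged labels: a dictionary event and an ordinal (shape = `Prod.fst`) [folklore] -/
abbrev TEv := PEv × ℕ

/-- a class-`8` region born at step `0` (fat waiting `3`, window `3 + 2 + 1 = 6` for `R ≡ 2`: booked reach `6`)
renewed EARLY at physical readiness `h + 1 = 3 < 6`. [folklore] -/
def early : Gen TEv := Gen.renew (Gen.born (((0, 0, 8) : PEv), 0) 0) (((3, 1, 0) : PEv), 0) 2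

/-- the fat waiting time of class `8` is `max 1 ⌊log₂ 8⌋ = 3` [folklore] -/
theorem fatWait_eight : fatWait 8 = 3 := by decide

/-- it is `ConsistentTLE` at every cutoff `K ≥ 3` … [folklore] -/
theorem early_consistentTLE {K : ℕ} (hK : 3 ≤ K) : ConsistentTLE Prod.fst C₀ K (fun _ => 2) early := by
  simp only [early, ConsistentTLE, Gen.reach_born, dictWT_apply, dictW_birth, fatWait_eight, PEv.kind_mk,
    PEv.step_mk, true_and]
  omega

/-- … but NOT `ConsistentT` (the renewal-at-reach clause `3 = 6` fails) … [folklore] -/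
theorem early_not_consistentT (K : ℕ) : ¬ ConsistentT Prod.fst C₀ K (fun _ => 2) early := by
  simp only [early, ConsistentT, Gen.reach_born, dictWT_apply, dictW_birth, fatWait_eight, PEv.kind_mk,
    PEv.step_mk, true_and]
  omega

/-- … and fresh, so `HistoryBankingLEInduction.bankedLE_induction` prices it. [folklore] -/
theorem early_fresh : FreshT early := by
  simp [early, FreshT]

/-- the life cost of the early renewal is below its total booked cost (the general inequality, instantiated). -/
example {K : ℕ} :
    lifeCost (dictWT Prod.fst (fun _ => 2) C₀.n₁) (costT Prod.fst C₀ K (fun _ => 2)) early ≤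
      totalCostT Prod.fst C₀ K (fun _ => 2) early :=
  lifeCost_le_totalCostT C₀_valid.E₂_nonneg C₀_valid.E₃_nonneg early

end Sanity

end

end Summit.QuantumFields.BalabanUV.T4Continuum.HistoryBankingLE
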